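import Summits.Ventures.DiscreteObjects.Hadamard.FixedSubmatrixOrth

/-!
# Hadamard 668 census, family F12 — order 23: an automorphism of H(668) fixes 1 or 24 rows, and in the second case the fixed 24×24 submatrix is a Hadamard matrix of order 24 (kernel)

Framing: lottery ticket; floor = certified bounds/negative ranges.

Cell pub-namedobj (venture DiscreteObjects), target (H), hadamard gen 9.  Let `H` be a Hadamard matrix of order `668` and
`(π, κ, d, e)` a signed-permutation automorphism with `π^23 = κ^23 = 1`, `(π, κ) ≠ (1, 1)`.

* `hadamard668_fixedRows_23`: **either `π` fixes exactly one row and `κ` exactly one column (the fixed-point-free `29 + 29`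
  orbit type of the underlying 2-(667,333,166) structure), or `π` fixes exactly `24` rows and `κ` exactly `24` columns**
  (transfer `transfer668` + the design-level theorem `fixedSubstructure_23`; the mixed case is impossible).
* `hadamard_fixedRows_orth_of_even_lt` (general, any order): for an odd prime `p` with `κ^p = 1`, if the number `f` of
  `κ`-fixed columns is EVEN and `f < 2p`, then two distinct `π`-fixed rows are orthogonal on the fixed columns (and on the moved
  columns).  Refines `hadamard_fixedRows_orth_of_card_lt` (`f < p`): the fixed part of the vanishing row product is divisible by
  `p`, has absolute value `≤ f < 2p`, and has the parity of `f`; an even multiple of the odd prime `p` of absolute value `< 2p`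
  is `0`.
* `hadamard668_fixedSubmatrix_23` / `_cols`: in the `24`-row case **the `24 × 24` submatrix on fixed rows × fixed columns is a
  Hadamard matrix of order `24`**, and distinct fixed rows are orthogonal on the `644` moved columns as well.  This is identity
  (R3) `23·C Cᵀ + F Fᵀ = 668·I` ⇒ `F Fᵀ = 24·I`, `C Cᵀ = 28·I` of the 'Hadamard form' of the orbit matrix (FAMILY-F12-G7 §2) for
  the last member `p = 23` (`f + 1 = 24 < 2p`) of the family `(p+1)(f+5) = 672`; the members `p = 83` (`F` of order 4) and
  `p = 41` (`F` of order 12) are `hadamard668_fixedSubmatrix_83` and `hadamard668_fixedSubmatrix_41`.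
Ours, not literature; no `sorry`; no `decide` beyond the imported files.
-/

open Finset BigOperators Matrix

namespace Summit.Ventures.DiscreteObjects.Hadamard

open Literature.Combinatorics.Designs.GoethalsSeidel (IsHadamardMatrix)

variable {ι : Type*} [Fintype ι] [DecidableEq ι]

omit [Fintype ι] [DecidableEq ι] in
/-- a sum of `±1` values over `s` has the parity of `s.card`: `2 ∣ (∑_{s} g) - #s` -/
lemma two_dvd_sum_pm_sub_card (s : Finset ι) (g : ι → ℤ) (hg : ∀ j ∈ s, g j = 1 ∨ g j = -1) :
    (2 : ℤ) ∣ ∑ j ∈ s, g j - s.card := by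
  classical
  induction s using Finset.induction_on with
  | empty => simp
  | insert a s ha ih =>
    rw [Finset.sum_insert ha, Finset.card_insert_of_notMem ha]
    have ih' := ih (fun j hj => hg j (Finset.mem_insert_of_mem hj))
    push_cast
    rcases hg a (Finset.mem_insert_self a s) with h | h
    · rw [h]
      have e : (1 : ℤ) + ∑ j ∈ s, g j - ((s.card : ℤ) + 1) = ∑ j ∈ s, g j - s.card := by ring
      rw [e]; exact ih'
    · rw [h]
      have e : (-1 : ℤ) + ∑ j ∈ s, g j - ((s.card : ℤ) + 1) = (∑ j ∈ s, g j - s.card) - 2 := by ring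
      rw [e]; exact dvd_sub ih' (dvd_refl 2)

/-- **Fixed rows are orthogonal on the fixed columns** whenever the number `f` of `κ`-fixed columns is even and `f < 2p`
(`p` an odd prime, `κ^p = 1`): for distinct `π`-fixed rows `u ≠ u'`, `∑_{κ j = j} H u j * H u' j = 0` and
`∑_{κ j ≠ j} H u j * H u' j = 0`. -/
theorem hadamard_fixedRows_orth_of_even_lt {H : Matrix ι ι ℤ} (hH : IsHadamardMatrix H)
    (π κ : Equiv.Perm ι) (d e : ι → ℤ) (haut : IsSignedAut H π κ d e)
    {p : ℕ} (hp : p.Prime) (hodd : Odd p) (hκ : κ ^ p = 1)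
    (heven : Even (univ.filter fun j => κ j = j).card)
    (hlt : (univ.filter fun j => κ j = j).card < 2 * p)
    {u u' : ι} (hu : π u = u) (hu' : π u' = u') (huu' : u ≠ u') :
    ∑ j ∈ univ.filter (fun j => κ j = j), H u j * H u' j = 0 ∧
    ∑ j ∈ univ.filter (fun j => κ j ≠ j), H u j * H u' j = 0 := by
  have htot : ∑ j, H u j * H u' j = 0 := hadamard_row_orth H hH huu'
  have hsplit : ∑ j, H u j * H u' j =
      ∑ j ∈ univ.filter (fun j => κ j = j), H u j * H u' j + ∑ j ∈ univ.filter (fun j => κ j ≠ j), H u j * H u' j := by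
    rw [← Finset.sum_filter_add_sum_filter_not univ (fun j => κ j = j)]
  have hsign : d u * d u' = 1 := by
    obtain ⟨j₀⟩ : Nonempty ι := ⟨u⟩
    exact fixedRows_sign_eq_odd hH haut hodd hκ hu hu' j₀
  have hdvd : (p : ℤ) ∣ ∑ j ∈ univ.filter (fun j => κ j ≠ j), H u j * H u' j :=
    dvd_sum_moved κ hp hκ (fun j => H u j * H u' j) (by
      intro y₀ _ i
      have e := fixedRows_prod_pow haut hu hu' i y₀
      rw [hsign, one_pow, one_mul] at e
      exact e)
  -- the fixed part: absolute value ≤ f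
  have hbound : |∑ j ∈ univ.filter (fun j => κ j = j), H u j * H u' j| ≤ (univ.filter fun j => κ j = j).card := by
    calc |∑ j ∈ univ.filter (fun j => κ j = j), H u j * H u' j|
        ≤ ∑ j ∈ univ.filter (fun j => κ j = j), |H u j * H u' j| := Finset.abs_sum_le_sum_abs _ _
      _ = ∑ j ∈ univ.filter (fun j => κ j = j), (1 : ℤ) := by
          apply Finset.sum_congr rfl
          intro j _
          rw [abs_mul]
          have a1 : |H u j| = 1 := by rcases hH.1 u j with h | h <;> simp [h]
          have a2 : |H u' j| = 1 := by rcases hH.1 u' j with h | h <;> simp [h]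
          rw [a1, a2, mul_one]
      _ = ((univ.filter fun j => κ j = j).card : ℤ) := by rw [Finset.sum_const, nsmul_eq_mul, mul_one]
  -- the fixed part: parity of f, hence even
  have hpar : (2 : ℤ) ∣ ∑ j ∈ univ.filter (fun j => κ j = j), H u j * H u' j := by
    have h2 := two_dvd_sum_pm_sub_card (univ.filter fun j => κ j = j) (fun j => H u j * H u' j) (by
      intro j _
      rcases hH.1 u j with h | h <;> rcases hH.1 u' j with h' | h' <;> simp [h, h'])
    obtain ⟨c, hc⟩ := heven
    have hcard : (2 : ℤ) ∣ ((univ.filter fun j => κ j = j).card : ℤ) := ⟨c, by rw [hc]; push_cast; ring⟩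
    have := dvd_add h2 hcard
    simpa using this
  -- the fixed part: divisible by p
  have hfix_dvd : (p : ℤ) ∣ ∑ j ∈ univ.filter (fun j => κ j = j), H u j * H u' j := by
    have e : ∑ j ∈ univ.filter (fun j => κ j = j), H u j * H u' j =
        -(∑ j ∈ univ.filter (fun j => κ j ≠ j), H u j * H u' j) := by linarith [hsplit, htot]
    rw [e]; exact (dvd_neg).mpr hdvd
  have hfix : ∑ j ∈ univ.filter (fun j => κ j = j), H u j * H u' j = 0 := by
    obtain ⟨k, hk⟩ := hfix_dvd
    have hp0 : (0 : ℤ) < p := by exact_mod_cast hp.pos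
    -- |k| ≤ 1
    have hpk : |(p : ℤ) * k| < 2 * p := by
      rw [← hk]
      calc |∑ j ∈ univ.filter (fun j => κ j = j), H u j * H u' j|
          ≤ ((univ.filter fun j => κ j = j).card : ℤ) := hbound
        _ < 2 * p := by exact_mod_cast hlt
    rw [abs_mul, abs_of_pos hp0] at hpk
    have hk1 : |k| < 2 := by
      by_contra hc
      have hc' : 2 ≤ |k| := le_of_not_gt hc
      have : (p : ℤ) * 2 ≤ (p : ℤ) * |k| := mul_le_mul_of_nonneg_left hc' hp0.le
      linarith
    -- k is even: 2 ∣ p * k with p odd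
    have hk2 : (2 : ℤ) ∣ k := by
      rw [hk] at hpar
      obtain ⟨q, hq⟩ := hodd
      have hpodd : Odd (p : ℤ) := ⟨q, by exact_mod_cast hq⟩
      rcases (Int.even_or_odd k) with hke | hko
      · exact even_iff_two_dvd.mp hke
      · exfalso
        have : Odd ((p : ℤ) * k) := hpodd.mul hko
        exact (Int.not_even_iff_odd.mpr this) (even_iff_two_dvd.mpr hpar)
    have hk0 : k = 0 := by
      obtain ⟨t, ht⟩ := hk2
      have := abs_lt.mp hk1
      omega
    rw [hk, hk0, mul_zero]
  refine ⟨hfix, ?_⟩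
  linarith [hsplit, htot]

/-- fixed row and column of a nontrivial signed automorphism of odd prime order `p ∤ 668`, with `π ≠ 1`
(the same bookkeeping as in `AutomorphismFixedRows668`) -/
private lemma fixed_row_col_23 {H : Matrix ι ι ℤ} (hH : IsHadamardMatrix H) (hι : Fintype.card ι = 668)
    (π κ : Equiv.Perm ι) (d e : ι → ℤ) (haut : IsSignedAut H π κ d e)
    (hπ : π ^ 23 = 1) (hκ : κ ^ 23 = 1) (hne : π ≠ 1 ∨ κ ≠ 1) :
    π ≠ 1 ∧ (∃ r, π r = r) ∧ (∃ c, κ c = c) := by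
  have hcard : (Fintype.card ι : ℤ) ≠ 0 := by rw [hι]; norm_num
  have hodd : Odd 23 := by decide
  have hπ1 : π ≠ 1 := by
    rcases hne with h | h
    · exact h
    · intro hπ1
      apply h
      rw [hπ1] at haut
      exact signedAut_snd_eq_one H hH hcard haut hodd hκ
  have hnd : ¬ 23 ∣ Fintype.card ι := by rw [hι]; norm_num
  haveI : Fact (23 : ℕ).Prime := ⟨by norm_num⟩
  exact ⟨hπ1, Equiv.Perm.exists_fixed_point_of_prime (n := 1) hnd (σ := π) (by rw [pow_one]; exact hπ),
    Equiv.Perm.exists_fixed_point_of_prime (n := 1) hnd (σ := κ) (by rw [pow_one]; exact hκ)⟩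

/-- **Order 23: `1 + 1` or `24 + 24` fixed rows and columns.**  A signed-permutation automorphism `(π, κ, d, e)` of a Hadamard
matrix of order `668` with `π^23 = κ^23 = 1`, `(π, κ) ≠ (1, 1)` fixes either exactly one row and exactly one column, or exactly
`24` rows and exactly `24` columns. -/
theorem hadamard668_fixedRows_23 {H : Matrix ι ι ℤ} (hH : IsHadamardMatrix H) (hι : Fintype.card ι = 668)
    (π κ : Equiv.Perm ι) (d e : ι → ℤ) (haut : IsSignedAut H π κ d e)
    (hπ : π ^ 23 = 1) (hκ : κ ^ 23 = 1) (hne : π ≠ 1 ∨ κ ≠ 1) :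
    ((univ.filter fun i => π i = i).card = 1 ∧ (univ.filter fun j => κ j = j).card = 1) ∨
    ((univ.filter fun i => π i = i).card = 24 ∧ (univ.filter fun j => κ j = j).card = 24) := by
  obtain ⟨hπ1, ⟨r, hr⟩, ⟨c, hc⟩⟩ := fixed_row_col_23 hH hι π κ d e haut hπ hκ hne
  obtain ⟨hπr, hκc, h01, hrow, hpair, hcol, hcpair, hP, hB, hN, hρ, hτ, x₀, hx₀⟩ :=
    transfer668 hH hι 23 π κ d e haut hπ hκ hπ1 hr hc
  have h := fixedSubstructure_23 (fun (x : {i // i ≠ r}) (y : {j // j ≠ c}) => inc H r c x.1 y.1) h01 hrow hpair hcol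
    hcpair hP hB (π.subtypePerm hπr) (κ.subtypePerm hκc) hN hρ hτ x₀ hx₀
  rw [card_fixed_eq_succ π r hr hπr, card_fixed_eq_succ κ c hc hκc]
  rcases h with ⟨hB0, hP0⟩ | ⟨⟨hB23, -, -⟩, hP23, -, -⟩
  · left; exact ⟨by rw [hP0], by rw [hB0]⟩
  · right; exact ⟨by rw [hP23], by rw [hB23]⟩

/-- **Order 23, the `24`-row case: the fixed `24 × 24` submatrix is a Hadamard matrix of order 24** (row form), and distinct
fixed rows are orthogonal on the moved columns: if `κ` fixes `24` columns then `π` fixes `24` rows and for `π`-fixed rows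
`u, u'`: `∑_{κ j = j} H u j * H u' j = 24·[u = u']` and `∑_{κ j ≠ j} H u j * H u' j = 644·[u = u']`. -/
theorem hadamard668_fixedSubmatrix_23 {H : Matrix ι ι ℤ} (hH : IsHadamardMatrix H) (hι : Fintype.card ι = 668)
    (π κ : Equiv.Perm ι) (d e : ι → ℤ) (haut : IsSignedAut H π κ d e)
    (hπ : π ^ 23 = 1) (hκ : κ ^ 23 = 1) (h24 : (univ.filter fun j => κ j = j).card = 24) :
    (univ.filter fun i => π i = i).card = 24 ∧
    ∀ u u' : ι, π u = u → π u' = u' →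
      (∑ j ∈ univ.filter (fun j => κ j = j), H u j * H u' j = if u = u' then 24 else 0) ∧
      (∑ j ∈ univ.filter (fun j => κ j ≠ j), H u j * H u' j = if u = u' then 644 else 0) := by
  have hne : π ≠ 1 ∨ κ ≠ 1 := by
    right
    intro hκ1
    rw [hκ1] at h24
    have : (univ.filter fun j : ι => (1 : Equiv.Perm ι) j = j).card = 668 := by
      rw [← hι, ← Finset.card_univ]
      congr 1
      ext j
      simp
    omega
  have hrows : (univ.filter fun i => π i = i).card = 24 := by
    rcases hadamard668_fixedRows_23 hH hι π κ d e haut hπ hκ hne with ⟨-, h1⟩ | ⟨h, -⟩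
    · omega
    · exact h
  refine ⟨hrows, ?_⟩
  intro u u' hu hu'
  have hmoved_card : (univ.filter fun j => κ j ≠ j).card = 644 := by
    have h1 := Finset.card_filter_add_card_filter_not (s := (univ : Finset ι)) (fun j => κ j = j)
    rw [Finset.card_univ, hι, h24] at h1
    simp only [ne_eq]
    omega
  by_cases huu' : u = u'
  · subst huu'
    rw [if_pos rfl, if_pos rfl]
    constructor
    · calc ∑ j ∈ univ.filter (fun j => κ j = j), H u j * H u j
          = ∑ j ∈ univ.filter (fun j => κ j = j), (1 : ℤ) := by
            apply Finset.sum_congr rfl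
            intro j _
            exact pm_mul_self (hH.1 u j)
        _ = 24 := by rw [Finset.sum_const, nsmul_eq_mul, mul_one, h24]; norm_num
    · calc ∑ j ∈ univ.filter (fun j => κ j ≠ j), H u j * H u j
          = ∑ j ∈ univ.filter (fun j => κ j ≠ j), (1 : ℤ) := by
            apply Finset.sum_congr rfl
            intro j _
            exact pm_mul_self (hH.1 u j)
        _ = 644 := by rw [Finset.sum_const, nsmul_eq_mul, mul_one, hmoved_card]; norm_num
  · rw [if_neg huu', if_neg huu']
    have heven : Even (univ.filter fun j => κ j = j).card := by rw [h24]; decide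
    have hlt : (univ.filter fun j => κ j = j).card < 2 * 23 := by rw [h24]; norm_num
    exact hadamard_fixedRows_orth_of_even_lt hH π κ d e haut (by norm_num) (by decide) hκ heven hlt hu hu' huu'

/-- **Column form** (the row form for `Hᵀ` with the automorphism `(κ, π, e, d)`): if `π` fixes `24` rows then `κ` fixes `24`
columns and for `κ`-fixed columns `v, v'`: `∑_{π i = i} H i v * H i v' = 24·[v = v']`,
`∑_{π i ≠ i} H i v * H i v' = 644·[v = v']`. -/
theorem hadamard668_fixedSubmatrix_23_cols {H : Matrix ι ι ℤ} (hH : IsHadamardMatrix H) (hι : Fintype.card ι = 668)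
    (π κ : Equiv.Perm ι) (d e : ι → ℤ) (haut : IsSignedAut H π κ d e)
    (hπ : π ^ 23 = 1) (hκ : κ ^ 23 = 1) (h24 : (univ.filter fun i => π i = i).card = 24) :
    (univ.filter fun j => κ j = j).card = 24 ∧
    ∀ v v' : ι, κ v = v → κ v' = v' →
      (∑ i ∈ univ.filter (fun i => π i = i), H i v * H i v' = if v = v' then 24 else 0) ∧
      (∑ i ∈ univ.filter (fun i => π i ≠ i), H i v * H i v' = if v = v' then 644 else 0) := by
  have hT : IsHadamardMatrix Hᵀ := isHadamard_transpose hH (by rw [hι]; norm_num)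
  have hautT : IsSignedAut Hᵀ κ π e d := by
    obtain ⟨hd, he, h⟩ := haut
    refine ⟨he, hd, fun j i => ?_⟩
    rw [Matrix.transpose_apply, Matrix.transpose_apply, h i j]; ring
  have h := hadamard668_fixedSubmatrix_23 hT hι κ π e d hautT hκ hπ h24
  refine ⟨h.1, ?_⟩
  intro v v' hv hv'
  have h' := h.2 v v' hv hv'
  simpa [Matrix.transpose_apply] using h'

end Summit.Ventures.DiscreteObjects.Hadamard
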